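import Summits.BirchSwinnertonDyer.Rank1Residual.X1.RankZeroDoubleTwistBSDp
import Literature.NumberTheory.QuadraticFields.FundamentalDiscriminant
import Literature.NumberTheory.EllipticCurves.HeegnerPointsImaginaryQuadraticProofs
import Literature.NumberTheory.EllipticCurves.AnalyticRankOrderProofs
import Literature.NumberTheory.EllipticCurves.HeegnerHypothesisKroneckerProofs
import Mathlib.Tactic.NormNum.LegendreSymbol
import HarnessLib

/-!
# Row A3 per pair on the DOUBLE-TWIST road (B-ii): the ASSEMBLY KIT — from two explicit minimal twist models,
# two fundamental discriminants with their Heegner conditions, and three instrument readings to the datum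
# `DoubleTwistPartnerAt W p`, and on to Mazur's main conjecture / `BSD(E,p)` at a rank-0 X1 pair
# (cell `bsd-eis`, seat `bsd-eis-k5-c5` g3; batch DT-1 of planner RULING L20; THEOREMS ONLY, nothing booked)

HONEST FRAMING (FULL-BSD rank-≤1 programme D-0033, cell `bsd-eis`, home `run/shared/lean/pub/bsd-eis/`; ladder row
A3 = class X1 ∩ {r_an = 0} — good anomalous Eisenstein `p > 2`, `E[p]` reducible, parity type A; crux 5
`MazurMCOnX1RankZero` of route `EisensteinPrimes`, item stmt-BirchSwinnertonDyer-19035, which stays OPEN).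
Nothing class-wide is claimed. The predecessor seat (k5-c5 g2) typed the per-pair certificate datum
`X1.RankZeroDoubleTwist.DoubleTwistPartnerAt W p` (p437784) — an admissible `K` with `ord L(E^{(d_K)}) = 1`, an
admissible `K'` for `E^{(d_K)}` with `L(E^{(d_K d_{K'})},1) ≠ 0`, a curve isogenous to the double twist with
`p ∤ #Ш_an` — and proved that, granted `h308` (Keller–Yin Thm. 3.0.8, PRE) and PUBLISHED named facts, it gives
`BSD(E,p)` and Mazur's main conjecture at the leaf pair read at the leaf curve (p439086,
`RankZeroDoubleTwistTransport.Leaf.{bsdp,mazurMainConjecture}_of_h308_of_doubleTwistPartnerAt`). This file is the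
glue between that datum and what a per-pair DISPLAY can certify in the kernel:
* §1 `doubleTwistPartnerAt_of_models` — from INTEGER data: two fundamental discriminants `dK`, `dK'` (odd, `< -4`),
  globally minimal models `Wd` of `W^{(dK)}` and `Wdd` of `Wd^{(dK')}` with their twist-model identities, the Heegner
  conditions stated for EVERY quadratic field of the given discriminant (so that a display proves them by Kronecker
  symbols, `satisfiesHeegnerHypothesis_iff_kronecker`), and the three READ binders `r_an(Wd) = 1`, `r_an(Wdd) = 0`,
  `ord_p #Ш_an(Wdd) = 0` (the certificate sits AT the double twist itself, `Wc := Wdd`); the fields are instantiated by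
  `Quadratic.exists_numberField_discr_eq`, `L(Wdd,1) ≠ 0` comes from `r_an(Wdd) = 0` by `analyticRank_eq_zero_iff`
  (modularity `hmod`) and is moved to the tree's twist model by `entireLFunction_smul`;
* §3 `satisfiesHeegnerHypothesis_of_jacobiSym`, `satisfiesHeegnerHypothesis_three_of_discr` — the `p`-split
  condition from one Jacobi symbol, stated once for all displays;
* §2 `mazurMainConjecture_of_models`, `bsdp_of_models` — the two display heads: `ClassX1 W p`, `r_an(W) = 0`, the §1
  data, `h308` [PRE] and the PUBLISHED facts [named binders] ⟹ `Rank1ResidualX1Defs.MazurMainConjecture W p`, `BSDp W p`.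
Per-pair files `X1/DoubleTwistDisplay<label>.lean` supply the kernel certificates (equations, minimality,
`ClassX1`, twist identities, Kronecker symbols) and leave the four readings as binders. NOT claimed: the class
statement, the rider `DoubleTwistCertificateSupply`, Keller–Yin Thm. 3.0.8, any reading in the kernel.
Refs: [KellerYin2024] Thm. 3.0.8, proof of Thm. 4.2.1 (display only); [Wuthrich2014] Prop. 21; [GrossLMS1991] §1;
[BirchSwinnertonDyer1965] (order of vanishing vs. value); Marcus, *Number Fields*, Ch. 2 Thm. 1 (quadratic fields ↔
fundamental discriminants).
-/

set_option autoImplicit false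

noncomputable section

open scoped Classical

open WeierstrassCurve NumberField IsDedekindDomain Field
  Literature.NumberTheory.EllipticCurves
  Literature.NumberTheory.EllipticCurves.ModularForms
  Literature.NumberTheory.QuadraticFields
  Literature.NumberTheory.EllipticCurves.Rank1Residual
  Literature.NumberTheory.EllipticCurves.CastellaGrossiLeeSkinner2022
  Literature.NumberTheory.EllipticCurves.KellerYin2024
  Summit.BirchSwinnertonDyer.Rank1Residual.X1.RankZeroDoubleTwist
  Summit.BirchSwinnertonDyer.Rank1Residual.X1.RankZeroDoubleTwistTransport
  Summit.BirchSwinnertonDyer.BirchSwinnertonDyer.Theorems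
  Summit.BirchSwinnertonDyer.BirchSwinnertonDyer.Theorems.Rank1ResidualX1Defs

namespace Summit.BirchSwinnertonDyer.Rank1Residual.X1.DoubleTwistDisplayKit

variable {p : ℕ} [Fact p.Prime]

/-! ## §1 The datum from integer data and three readings -/

/-- **`DoubleTwistPartnerAt W p` from explicit models.** Data: globally minimal elliptic `W`, `Wd`, `Wdd` over `ℚ`;
integers `dK`, `dK'` that are fundamental discriminants (`hfK`, `hfK'`, in the disjunctive form of
`Quadratic.exists_numberField_discr_eq`), odd and `< -4`; the Heegner conditions for `(N(W), dK)`, `(p, dK)`,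
`(N(Wd), dK')`, `(p, dK')` stated for every quadratic field of that discriminant; the twist-model identities
`C • Wd = W^{(dK)}`, `C' • Wdd = Wd^{(dK')}` (tree model `WeierstrassCurve.quadraticTwist`); the READ binders
`hrd : r_an(Wd) = 1`, `hrdd : r_an(Wdd) = 0`, `hunit : ord_p #Ш_an(Wdd) = 0`; modularity `hmod` (to turn
`r_an(Wdd) = 0` into `L(Wdd,1) ≠ 0`). Conclusion: the double-twist certificate datum at `(W, p)` with `Wc := Wdd`.
[cite: KellerYin2024, proof of Thm. 4.2.1 (the display; nothing asserted)] [cite: Wuthrich2014, Prop. 21 (p. 400)]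
[cite: BirchSwinnertonDyer1965] -/
theorem doubleTwistPartnerAt_of_models (hmod : exists_isNewformOf)
    (W Wd Wdd : WeierstrassCurve ℚ) [W.IsElliptic] [Wd.IsElliptic] [Wd.IsGloballyMinimal]
    [Wdd.IsElliptic] [Wdd.IsGloballyMinimal] (dK dK' : ℤ)
    (hfK : (dK % 4 = 1 ∧ Squarefree dK ∧ dK ≠ 1) ∨
      (4 ∣ dK ∧ (dK / 4 % 4 = 2 ∨ dK / 4 % 4 = 3) ∧ Squarefree (dK / 4)))
    (hfK' : (dK' % 4 = 1 ∧ Squarefree dK' ∧ dK' ≠ 1) ∨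
      (4 ∣ dK' ∧ (dK' / 4 % 4 = 2 ∨ dK' / 4 % 4 = 3) ∧ Squarefree (dK' / 4)))
    (hoddK : Odd dK) (hltK : dK < -4) (hoddK' : Odd dK') (hltK' : dK' < -4)
    (hHN : ∀ (K : Type) [Field K] [NumberField K], Module.finrank ℚ K = 2 → NumberField.discr K = dK →
      SatisfiesHeegnerHypothesis (W.conductorNorm ℤ) K)
    (hHp : ∀ (K : Type) [Field K] [NumberField K], Module.finrank ℚ K = 2 → NumberField.discr K = dK →
      SatisfiesHeegnerHypothesis p K)
    (hHN' : ∀ (K' : Type) [Field K'] [NumberField K'], Module.finrank ℚ K' = 2 → NumberField.discr K' = dK' →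
      SatisfiesHeegnerHypothesis (Wd.conductorNorm ℤ) K')
    (hHp' : ∀ (K' : Type) [Field K'] [NumberField K'], Module.finrank ℚ K' = 2 → NumberField.discr K' = dK' →
      SatisfiesHeegnerHypothesis p K')
    (hC : ∃ C : VariableChange ℚ, C • Wd = W.quadraticTwist (dK : ℚ))
    (hC' : ∃ C' : VariableChange ℚ, C' • Wdd = Wd.quadraticTwist (dK' : ℚ))
    (hrd : Wd.analyticRank = 1) (hrdd : Wdd.analyticRank = 0)
    (hunit : ∃ q : ℚ, shaAn Wdd = (q : ℂ) ∧ padicValRat p q = 0) :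
    DoubleTwistPartnerAt W p := by
  -- the fields
  obtain ⟨K, _, _, h2, hdK⟩ := Quadratic.exists_numberField_discr_eq hfK
  obtain ⟨K', _, _, h2', hdK'⟩ := Quadratic.exists_numberField_discr_eq hfK'
  have hK : IsImaginaryQuadratic K := isImaginaryQuadratic_iff_discr_neg.2 ⟨h2, by rw [hdK]; omega⟩
  have hK' : IsImaginaryQuadratic K' := isImaginaryQuadratic_iff_discr_neg.2 ⟨h2', by rw [hdK']; omega⟩
  -- `L(Wdd, 1) ≠ 0` from the reading `r_an(Wdd) = 0`, moved to the tree's twist model of `Wd^{(dK')}`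
  have hLdd : Wdd.entireLFunction 1 ≠ 0 :=
    (Wdd.analyticRank_eq_zero_iff_holds (hasEntireLFunction_rat_of_exists_isNewformOf hmod Wdd)).mp hrdd
  obtain ⟨C', hC'⟩ := hC'
  have hLt' : (Wd.quadraticTwist (NumberField.discr K' : ℚ)).entireLFunction 1 ≠ 0 := by
    rw [hdK', ← hC', WeierstrassCurve.entireLFunction_smul]
    exact hLdd
  exact ⟨K, inferInstance, inferInstance, hK, hdK ▸ hoddK, hdK ▸ hltK, hHN K h2 hdK, hHp K h2 hdK,
    Wd, inferInstance, inferInstance, (by rw [hdK]; exact hC), hrd,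
    K', inferInstance, inferInstance, hK', hdK' ▸ hoddK', hdK' ▸ hltK', hHN' K' h2' hdK', hHp' K' h2' hdK', hLt',
    Wdd, inferInstance, inferInstance, ⟨C', by rw [hdK']; exact hC'⟩,
    Wdd, inferInstance, inferInstance, isIsogenous_self _, hunit⟩

/-! ## §2 The display heads: Mazur's main conjecture and `BSD(E,p)` at a rank-0 X1 pair from the models -/

/-- **DISPLAY HEAD (row A3, road (B-ii)) — Mazur's main conjecture at a rank-`0` X1 pair** on the conclusion
`Rank1ResidualX1Defs.MazurMainConjecture W p` of crux 5, from: `h308` [PRE: Keller–Yin arXiv:2402.12781v2 Thm. 3.0.8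
(IMC2) at `𝟙` = the body of crux 2 `GoodLatticeBDPValue`]; the PUBLISHED named facts `h511` (CGLS Thm. 5.1.1),
`hW21` (Wuthrich Prop. 21), `hCassels`, `hmodP`, `hmod`, `hGZQ`, `hGZ`, `hKo`, `hGZK`, `hW16` (Wuthrich Thm. 16),
`hGr` (Greenberg Thm. 4.1); the per-pair certificate (`hX1 : ClassX1 W p`, the model data of §1); and the READ
binders `hr : r_an(W) = 0`, `hrd`, `hrdd`, `hunit`. Head of the chain:
`RankZeroDoubleTwistTransport.Leaf.mazurMainConjecture_of_h308_of_doubleTwistPartnerAt`. Nothing booked.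
[claim: KellerYin2024, status: under-review] [cite: KellerYin2024, Thm. 3.0.8 (IMC2), Prop. 1.3.1, proof of Thm. 4.2.1]
[cite: CastellaGrossiLeeSkinner2022, Thm. 5.1.1, Thm. 5.3.1 and its proof] [cite: Wuthrich2014, Thm. 16 (p. 397), Prop. 21 (p. 400)]
[cite: GreenbergLNM1716, Thm. 4.1] [cite: MilneADT2006, Thm. I.7.3] -/
theorem mazurMainConjecture_of_models
    (h308 : thm308_imc2_bdpValue_goodLattice_OPEN) (h511 : thm511_anticyclotomicControl_of_torsionFree)
    (hW21 : Wuthrich2014.sha_dvd_analyticSha) (hCassels : bsdRHS_eq_of_isIsogenous)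
    (hmodP : nonempty_modularParametrizationData) (hmod : exists_isNewformOf)
    (hGZQ : GrossZagier1986_thm_I_7_3)
    (hGZ : ∀ (N : ℕ) [NeZero N] (W : WeierstrassCurve ℚ) (K : Type) [Field K] [NumberField K],
      gross_zagier N W K)
    (hKo : ∀ (N : ℕ) [NeZero N] (W : WeierstrassCurve ℚ) (K : Type) [Field K] [NumberField K],
      kolyvagin N W K)
    (hGZK : rank_eq_analyticRank_of_analyticRank_le_one)
    (hW16 : Wuthrich2014.charIdeal_dvd_padicLFunction) (hGr : greenberg_charValue_rankZero)
    (W Wd Wdd : WeierstrassCurve ℚ) [W.IsElliptic] [W.IsGloballyMinimal] [Wd.IsElliptic] [Wd.IsGloballyMinimal]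
    [Wdd.IsElliptic] [Wdd.IsGloballyMinimal] (hX1 : ClassX1 W p) (dK dK' : ℤ)
    (hfK : (dK % 4 = 1 ∧ Squarefree dK ∧ dK ≠ 1) ∨
      (4 ∣ dK ∧ (dK / 4 % 4 = 2 ∨ dK / 4 % 4 = 3) ∧ Squarefree (dK / 4)))
    (hfK' : (dK' % 4 = 1 ∧ Squarefree dK' ∧ dK' ≠ 1) ∨
      (4 ∣ dK' ∧ (dK' / 4 % 4 = 2 ∨ dK' / 4 % 4 = 3) ∧ Squarefree (dK' / 4)))
    (hoddK : Odd dK) (hltK : dK < -4) (hoddK' : Odd dK') (hltK' : dK' < -4)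
    (hHN : ∀ (K : Type) [Field K] [NumberField K], Module.finrank ℚ K = 2 → NumberField.discr K = dK →
      SatisfiesHeegnerHypothesis (W.conductorNorm ℤ) K)
    (hHp : ∀ (K : Type) [Field K] [NumberField K], Module.finrank ℚ K = 2 → NumberField.discr K = dK →
      SatisfiesHeegnerHypothesis p K)
    (hHN' : ∀ (K' : Type) [Field K'] [NumberField K'], Module.finrank ℚ K' = 2 → NumberField.discr K' = dK' →
      SatisfiesHeegnerHypothesis (Wd.conductorNorm ℤ) K')
    (hHp' : ∀ (K' : Type) [Field K'] [NumberField K'], Module.finrank ℚ K' = 2 → NumberField.discr K' = dK' →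
      SatisfiesHeegnerHypothesis p K')
    (hC : ∃ C : VariableChange ℚ, C • Wd = W.quadraticTwist (dK : ℚ))
    (hC' : ∃ C' : VariableChange ℚ, C' • Wdd = Wd.quadraticTwist (dK' : ℚ))
    (hr : W.analyticRank = 0) (hrd : Wd.analyticRank = 1) (hrdd : Wdd.analyticRank = 0)
    (hunit : ∃ q : ℚ, shaAn Wdd = (q : ℂ) ∧ padicValRat p q = 0) :
    Rank1ResidualX1Defs.MazurMainConjecture W p :=
  RankZeroDoubleTwistTransport.Leaf.mazurMainConjecture_of_h308_of_doubleTwistPartnerAt h308 h511 hW21 hCassels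
    hmodP hmod hGZQ hGZ hKo hGZK hW16 hGr W ⟨hX1, hr⟩
    (doubleTwistPartnerAt_of_models hmod W Wd Wdd dK dK' hfK hfK' hoddK hltK hoddK' hltK' hHN hHp hHN' hHp' hC
      hC' hrd hrdd hunit)

/-- **DISPLAY HEAD (row A3, road (B-ii)) — `BSD(E,p)`** (Miller's `BSDp`, the cell's booking currency) at a rank-`0`
X1 pair from the same data without `hW16` / `hGr`. Head of the chain:
`RankZeroDoubleTwistTransport.Leaf.bsdp_of_h308_of_doubleTwistPartnerAt`. Nothing booked.
[claim: KellerYin2024, status: under-review] [cite: KellerYin2024, Thm. 3.0.8 (IMC2), Prop. 1.3.1, proof of Thm. 4.2.1]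
[cite: CastellaGrossiLeeSkinner2022, Thm. 5.1.1, Thm. 5.3.1 and its proof] [cite: Wuthrich2014, Prop. 21 (p. 400)]
[cite: MilneADT2006, Thm. I.7.3] [cite: Miller2011LMS, Def. 1.1] -/
theorem bsdp_of_models
    (h308 : thm308_imc2_bdpValue_goodLattice_OPEN) (h511 : thm511_anticyclotomicControl_of_torsionFree)
    (hW21 : Wuthrich2014.sha_dvd_analyticSha) (hCassels : bsdRHS_eq_of_isIsogenous)
    (hmodP : nonempty_modularParametrizationData) (hmod : exists_isNewformOf)
    (hGZQ : GrossZagier1986_thm_I_7_3)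
    (hGZ : ∀ (N : ℕ) [NeZero N] (W : WeierstrassCurve ℚ) (K : Type) [Field K] [NumberField K],
      gross_zagier N W K)
    (hKo : ∀ (N : ℕ) [NeZero N] (W : WeierstrassCurve ℚ) (K : Type) [Field K] [NumberField K],
      kolyvagin N W K)
    (hGZK : rank_eq_analyticRank_of_analyticRank_le_one)
    (W Wd Wdd : WeierstrassCurve ℚ) [W.IsElliptic] [W.IsGloballyMinimal] [Wd.IsElliptic] [Wd.IsGloballyMinimal]
    [Wdd.IsElliptic] [Wdd.IsGloballyMinimal] (hX1 : ClassX1 W p) (dK dK' : ℤ)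
    (hfK : (dK % 4 = 1 ∧ Squarefree dK ∧ dK ≠ 1) ∨
      (4 ∣ dK ∧ (dK / 4 % 4 = 2 ∨ dK / 4 % 4 = 3) ∧ Squarefree (dK / 4)))
    (hfK' : (dK' % 4 = 1 ∧ Squarefree dK' ∧ dK' ≠ 1) ∨
      (4 ∣ dK' ∧ (dK' / 4 % 4 = 2 ∨ dK' / 4 % 4 = 3) ∧ Squarefree (dK' / 4)))
    (hoddK : Odd dK) (hltK : dK < -4) (hoddK' : Odd dK') (hltK' : dK' < -4)
    (hHN : ∀ (K : Type) [Field K] [NumberField K], Module.finrank ℚ K = 2 → NumberField.discr K = dK →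
      SatisfiesHeegnerHypothesis (W.conductorNorm ℤ) K)
    (hHp : ∀ (K : Type) [Field K] [NumberField K], Module.finrank ℚ K = 2 → NumberField.discr K = dK →
      SatisfiesHeegnerHypothesis p K)
    (hHN' : ∀ (K' : Type) [Field K'] [NumberField K'], Module.finrank ℚ K' = 2 → NumberField.discr K' = dK' →
      SatisfiesHeegnerHypothesis (Wd.conductorNorm ℤ) K')
    (hHp' : ∀ (K' : Type) [Field K'] [NumberField K'], Module.finrank ℚ K' = 2 → NumberField.discr K' = dK' →
      SatisfiesHeegnerHypothesis p K')
    (hC : ∃ C : VariableChange ℚ, C • Wd = W.quadraticTwist (dK : ℚ))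
    (hC' : ∃ C' : VariableChange ℚ, C' • Wdd = Wd.quadraticTwist (dK' : ℚ))
    (hr : W.analyticRank = 0) (hrd : Wd.analyticRank = 1) (hrdd : Wdd.analyticRank = 0)
    (hunit : ∃ q : ℚ, shaAn Wdd = (q : ℂ) ∧ padicValRat p q = 0) : BSDp W p :=
  RankZeroDoubleTwistTransport.Leaf.bsdp_of_h308_of_doubleTwistPartnerAt h308 h511 hW21 hCassels hmodP hmod hGZQ
    hGZ hKo hGZK W ⟨hX1, hr⟩
    (doubleTwistPartnerAt_of_models hmod W Wd Wdd dK dK' hfK hfK' hoddK hltK hoddK' hltK' hHN hHp hHN' hHp' hC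
      hC' hrd hrdd hunit)

/-! ## §3 The `p`-split condition by a Kronecker symbol (shared by all per-pair displays) -/

/-- **An odd prime `q` splits in a quadratic field `K` when `(d_K/q) = 1`** — the `N = q` case of the decomposition
law `satisfiesHeegnerHypothesis_iff_kronecker`, in the form the per-pair displays discharge by `norm_num` on the
Jacobi symbol (e.g. `(-71/3) = 1`): this is the binder `hHp` / `hHp'` of `doubleTwistPartnerAt_of_models`. Stated once
here so that the displays do not restate it per discriminant. Marcus, *Number Fields*, Ch. 3 Thm. 25. [folklore] -/
theorem satisfiesHeegnerHypothesis_of_jacobiSym (K : Type) [Field K] [NumberField K]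
    (h2 : Module.finrank ℚ K = 2) {q : ℕ} (hq : q.Prime) (hq2 : q ≠ 2)
    (hj : jacobiSym (NumberField.discr K) q = 1) : SatisfiesHeegnerHypothesis q K := by
  rw [satisfiesHeegnerHypothesis_iff_kronecker q K h2]
  intro ℓ hℓ hℓq
  obtain rfl := (Nat.prime_dvd_prime_iff_eq hℓ hq).1 hℓq
  exact ⟨fun h ↦ absurd h hq2, fun _ ↦ hj⟩

/-- **`3` splits in every quadratic field of discriminant `d` with `(d/3) = 1`**, in the exact binder shape
`∀ K, finrank = 2 → discr K = d → SatisfiesHeegnerHypothesis 3 K` of `doubleTwistPartnerAt_of_models` (`hHp`, `hHp'`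
at `p = 3`); the displays supply `hj : jacobiSym d 3 = 1` by `norm_num`. [folklore] -/
theorem satisfiesHeegnerHypothesis_three_of_discr (d : ℤ) (hj : jacobiSym d 3 = 1)
    (K : Type) [Field K] [NumberField K] (h2 : Module.finrank ℚ K = 2) (hdK : NumberField.discr K = d) :
    SatisfiesHeegnerHypothesis 3 K :=
  satisfiesHeegnerHypothesis_of_jacobiSym K h2 Nat.prime_three (by norm_num) (by rw [hdK]; exact hj)

end Summit.BirchSwinnertonDyer.Rank1Residual.X1.DoubleTwistDisplayKit

end
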